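import Summits.QuantumFields.YangMills.Theorems.ParabolicTrajectoryContinuumLimitOnTrajectoryUclVarE
import Summits.QuantumFields.YangMills.Theorems.ParabolicTrajectoryContinuumLimitOnTrajectoryUclDefs

/-!
# Crux `ContinuumLimitOnTrajectory` (stmt-QuantumFields-10522), line `two-orbit-synchronisation` (seat c2):
# `VarBound` from `UUVB` (wave-2 helper W2-VAR of `stub_uclOfGap : UCLOfGap`) — the deciding theorem

Helper file (`--supports stmt-QuantumFields-10522`): `varBound_of_uuvb : UUVB r sch → VarBound r sch`, `VarBound` verbatim from
…UclDefs. The proof is …UclVarE's explicit form `Var.varBound_explicit_of_uuvb'` (the statement of `VarBound` with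
`planeRefl sch k T U = timeShiftInt _ (−T) (timeShiftInt _ T U).negReflect` written out, which is its definition), so this file
is definitional unfolding only; the mathematics (reflection identity, plaquette-string and Taylor expansions, `UUVB`, counting)
is in …UclVarA–E.
-/

set_option autoImplicit false

open scoped SchwartzMap ComplexConjugate
open MeasureTheory Filter Topology
open Literature.MathematicalPhysics.QuantumFieldTheory Literature.MathematicalPhysics.QuantumLattice
open Literature.MathematicalPhysics.AQFT Literature.Probability.LatticeModels

noncomputable section

namespace Summit.QuantumFields.YangMills.Cruxes.ContinuumLimitOnTrajectory.TwoOrbitSynchronisation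

/-- **THE DECIDING THEOREM of the wave-2 helper W2-VAR (registered anchor): `VarBound r sch` from `UUVB r sch`.** For every
arity `p` there are a Schwartz index, an exponent, a constant and ONE threshold in `k` beyond which the reflected self-pairing
`‖∫ obsOf Φ' · conj (obsOf Φ' ∘ planeRefl T) dμ_k‖` of the lattice observable of a locus-avoiding, time-windowed `p`-point test
function across a lattice time plane at least `R₀ + 2` units off its window (window and plane in the central eighth of the
torus) is at most `C (1 + |a_k T|)^κ |Φ'|²`. -/
theorem varBound_of_uuvb :
    ∀ {G : Type} [Group G] [TopologicalSpace G] [IsTopologicalGroup G] [CompactSpace G] [MeasurableSpace G] [BorelSpace G]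
      (r : LatticeRep G) (sch : SpeciesScheme (YMSpecies G)), UUVB r sch → VarBound r sch := by
  intro G _ _ _ _ _ _ r sch hU
  exact Var.varBound_explicit_of_uuvb' r sch hU

end Summit.QuantumFields.YangMills.Cruxes.ContinuumLimitOnTrajectory.TwoOrbitSynchronisation

end
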